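import Summits.PneNP.PneNP.Theorems.ClusUniversalCertificateCoordDefs
import Mathlib
import HarnessLib

/-!
# Route ClusUniversalCertificate — path `coord` on the crux `UniversalCertAll` (stmt-PneNP-19683): the two slices (FREE STEP)
(rung F-N1, cell pnp-ideate, planner p1 g6; registered skeleton HOME/pnp-ideate-p1/lines/layer.lean v6 sha16 ed80fa781593c29a, path `coord`;
stub `stub_slice`, M–L, WANTED for provers on STATUS 08:49Z)

The registered stub `stub_slice` of p1's path `coord`, BY NAME, against the objects of `ClusUniversalCertificateCoordDefs.lean`: for every
`Y ⊆ 𝔽₂^{M+1}` and every coordinate `i`, the two SLICES `slice Y i 0`, `slice Y i 1 ⊆ 𝔽₂^M` form a coordinate layer family for `(Y, i)`, and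
`D(Y) ≤ D(slice Y i 0) + D(slice Y i 1) + |Y|` — each point loses at most one dimension.

PROOF.  (Family) the fibre of `Fin.removeNth i` over `x` inside `Y` consists of those of `Fin.insertNth i 0 x`, `Fin.insertNth i 1 x` that lie in `Y`,
and `x ∈ slice Y i c ↔ Fin.insertNth i c x ∈ Y`.  (Loss ≤ 1) for `y ∈ Y` with `y_i = c` and an optimal flat `A ∋ y` inside `Y` with direction `D`:
the flat through `π_i y` with direction `π_i(D ⊓ ker e_i^*)` lies inside the slice (`AffineSubspace.mk'`), `π_i` is injective on `ker e_i^*`, and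
`dim (D ⊓ ker e_i^*) ≥ dim D − 1` (`Submodule.finrank_sup_add_finrank_inf_eq`); so `acodim (slice Y i c) (π_i y) ≤ acodim Y y`.  Summing over the two
slices re-indexed through `π_i` (`Finset.sum_image`) gives the inequality.

HONEST FRAMING: ONE registered stub (the free step of the coordinate induction) of an OPEN crux of route ClusUniversalCertificate; the load-bearing
stub `stub_cllZeroRare` is OPEN and XL; FRONTIER rung F-N1 — nothing here bears on P vs NP.
-/

set_option linter.dupNamespace false -- `Summit.PneNP.PneNP.…`: summit = sub-problem name (D-0017 single-conjunct layout)

-- BEGIN BODY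
namespace Summit.PneNP.PneNP.Theorems.ClusCoord

open Finset

section Slices

variable {M : ℕ}

/-- Membership in a slice: `x ∈ slice Y i c ↔ insertNth i c x ∈ Y`. -/
theorem mem_slice_iff (Y : Finset (Fin (M + 1) → ZMod 2)) (i : Fin (M + 1)) (c : ZMod 2) (x : Fin M → ZMod 2) :
    x ∈ slice Y i c ↔ Fin.insertNth i c x ∈ Y := by
  unfold slice
  rw [Finset.mem_image]
  constructor
  · rintro ⟨y, hy, rfl⟩
    obtain ⟨hyY, hyi⟩ := Finset.mem_filter.mp hy
    rw [← hyi, Fin.insertNth_self_removeNth]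
    exact hyY
  · intro h
    exact ⟨Fin.insertNth i c x, Finset.mem_filter.mpr ⟨h, by simp⟩, by simp⟩

/-- The fibre of `Fin.removeNth i` over `x` inside `Y` has `[insertNth i 0 x ∈ Y] + [insertNth i 1 x ∈ Y]` points. -/
theorem card_fibre_removeNth (Y : Finset (Fin (M + 1) → ZMod 2)) (i : Fin (M + 1)) (x : Fin M → ZMod 2) :
    (Y.filter fun y => Fin.removeNth i y = x).card =
      (if (Fin.insertNth i (0 : ZMod 2) x : Fin (M + 1) → ZMod 2) ∈ Y then 1 else 0) +
        (if (Fin.insertNth i (1 : ZMod 2) x : Fin (M + 1) → ZMod 2) ∈ Y then 1 else 0) := by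
  classical
  set a : Fin (M + 1) → ZMod 2 := Fin.insertNth i (0 : ZMod 2) x with ha
  set b : Fin (M + 1) → ZMod 2 := Fin.insertNth i (1 : ZMod 2) x with hb
  have hne : a ≠ b := by
    intro h
    have h0 := congrFun h i
    rw [ha, hb, Fin.insertNth_apply_same, Fin.insertNth_apply_same] at h0
    exact zero_ne_one h0
  have hset : (Y.filter fun y => Fin.removeNth i y = x) = (({a, b} : Finset (Fin (M + 1) → ZMod 2)).filter fun y => y ∈ Y) := by
    ext y
    simp only [Finset.mem_filter, Finset.mem_insert, Finset.mem_singleton]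
    constructor
    · rintro ⟨hyY, hyx⟩
      refine ⟨?_, hyY⟩
      rcases (by decide : ∀ c : ZMod 2, c = 0 ∨ c = 1) (y i) with h0 | h1
      · left; rw [ha, ← hyx, ← h0, Fin.insertNth_self_removeNth]
      · right; rw [hb, ← hyx, ← h1, Fin.insertNth_self_removeNth]
    · rintro ⟨hy, hyY⟩
      refine ⟨hyY, ?_⟩
      rcases hy with rfl | rfl
      · rw [ha]; simp
      · rw [hb]; simp
  rw [hset, Finset.filter_insert, Finset.filter_singleton]
  by_cases h0 : a ∈ Y <;> by_cases h1 : b ∈ Y <;> simp [h0, h1, hne]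

/-- The two slices form a coordinate layer family. -/
theorem isCLayerFamily_slices (Y : Finset (Fin (M + 1) → ZMod 2)) (i : Fin (M + 1)) :
    IsCLayerFamily Y i [slice Y i 0, slice Y i 1] := by
  classical
  intro x
  rw [card_fibre_removeNth]
  have h0 := mem_slice_iff Y i 0 x
  have h1 := mem_slice_iff Y i 1 x
  by_cases a : (Fin.insertNth i (0 : ZMod 2) x : Fin (M + 1) → ZMod 2) ∈ Y <;>
    by_cases b : (Fin.insertNth i (1 : ZMod 2) x : Fin (M + 1) → ZMod 2) ∈ Y <;>
      simp [h0, h1, a, b]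

/-- Deleting coordinate `i` as a linear map `𝔽₂^{M+1} → 𝔽₂^M` (it is `Fin.removeNth i`). -/
theorem funLeft_succAbove_apply (i : Fin (M + 1)) (z : Fin (M + 1) → ZMod 2) :
    LinearMap.funLeft (ZMod 2) (ZMod 2) (Fin.succAbove i) z = Fin.removeNth i z := rfl

/-- **Loss ≤ 1.** For `y ∈ Y` the certificate codimension of `π_i y` in the slice `{y_i = c}` is at most that of `y` in `Y`. -/
theorem acodim_slice_le (Y : Finset (Fin (M + 1) → ZMod 2)) (i : Fin (M + 1)) {y : Fin (M + 1) → ZMod 2} (hy : y ∈ Y) :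
    acodim M (slice Y i (y i)) (Fin.removeNth i y) ≤ acodim (M + 1) Y y := by
  classical
  -- an optimal flat through `y` inside `Y`
  have hne : {c : ℕ | ∃ A : AffineSubspace (ZMod 2) (Fin (M + 1) → ZMod 2), y ∈ A ∧ (∀ z ∈ A, z ∈ Y) ∧
      M + 1 ≤ Module.finrank (ZMod 2) A.direction + c}.Nonempty := by
    refine ⟨M + 1, affineSpan (ZMod 2) {y}, mem_affineSpan (ZMod 2) (Set.mem_singleton y), ?_, Nat.le_add_left _ _⟩
    intro z hz
    rw [AffineSubspace.mem_affineSpan_singleton] at hz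
    rw [hz]; exact hy
  obtain ⟨A, hyA, hAY, hc⟩ := Nat.sInf_mem hne
  unfold acodim
  apply Nat.sInf_le
  -- the linear data
  set π : (Fin (M + 1) → ZMod 2) →ₗ[ZMod 2] (Fin M → ZMod 2) := LinearMap.funLeft (ZMod 2) (ZMod 2) (Fin.succAbove i) with hπ
  set K : Submodule (ZMod 2) (Fin (M + 1) → ZMod 2) :=
    LinearMap.ker (LinearMap.proj i : (Fin (M + 1) → ZMod 2) →ₗ[ZMod 2] ZMod 2) with hK
  have hmemK : ∀ v : Fin (M + 1) → ZMod 2, v ∈ K ↔ v i = 0 := fun v => by rw [hK, LinearMap.mem_ker]; rfl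
  set D := A.direction with hD
  set D' : Submodule (ZMod 2) (Fin M → ZMod 2) := (D ⊓ K).map π with hD'
  refine ⟨AffineSubspace.mk' (Fin.removeNth i y) D', AffineSubspace.self_mem_mk' _ _, ?_, ?_⟩
  · -- the flat lies inside the slice
    intro z hz
    rw [AffineSubspace.mem_mk'] at hz
    obtain ⟨v, hv, hvz⟩ := Submodule.mem_map.mp hz
    obtain ⟨hvD, hvK⟩ := Submodule.mem_inf.mp hv
    have hvi : v i = 0 := (hmemK v).mp hvK
    have hz' : z = Fin.removeNth i (v + y) := by
      have h1 : z = π v + Fin.removeNth i y := by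
        rw [hvz, vsub_eq_sub, sub_add_cancel]
      rw [h1, hπ, funLeft_succAbove_apply]
      rfl
    have hvy : v + y ∈ A := by
      have := AffineSubspace.vadd_mem_of_mem_direction hvD hyA
      rwa [vadd_eq_add] at this
    rw [hz', mem_slice_iff]
    have hvi' : (v + y) i = y i := by rw [Pi.add_apply, hvi, zero_add]
    rw [← hvi', Fin.insertNth_self_removeNth]
    exact hAY _ hvy
  · -- dimension count
    rw [AffineSubspace.direction_mk']
    -- `π` is injective on `K`, so `finrank D' = finrank (D ⊓ K)`
    have hinj : Function.Injective (π ∘ₗ (D ⊓ K).subtype) := by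
      intro u w huw
      apply Subtype.ext
      have hu : (u : Fin (M + 1) → ZMod 2) i = 0 := (hmemK _).mp (Submodule.mem_inf.mp u.2).2
      have hw : (w : Fin (M + 1) → ZMod 2) i = 0 := (hmemK _).mp (Submodule.mem_inf.mp w.2).2
      have h' : Fin.removeNth i (u : Fin (M + 1) → ZMod 2) = Fin.removeNth i (w : Fin (M + 1) → ZMod 2) := huw
      rw [← Fin.insertNth_self_removeNth i (u : Fin (M + 1) → ZMod 2), ← Fin.insertNth_self_removeNth i (w : Fin (M + 1) → ZMod 2),
        hu, hw, h']
    have hD'rk : Module.finrank (ZMod 2) D' = Module.finrank (ZMod 2) ↥(D ⊓ K) := by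
      have h := LinearMap.finrank_range_of_inj hinj
      rw [LinearMap.range_comp, Submodule.range_subtype] at h
      rw [hD']
      exact h
    -- `finrank K + 1 = M + 1` and `finrank (D ⊔ K) ≤ M + 1`, so `finrank (D ⊓ K) + 1 ≥ finrank D`
    have hKrk : Module.finrank (ZMod 2) K + 1 = M + 1 := by
      have h := LinearMap.finrank_range_add_finrank_ker (LinearMap.proj i : (Fin (M + 1) → ZMod 2) →ₗ[ZMod 2] ZMod 2)
      have hr : LinearMap.range (LinearMap.proj i : (Fin (M + 1) → ZMod 2) →ₗ[ZMod 2] ZMod 2) = ⊤ :=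
        LinearMap.range_eq_top.mpr fun c => ⟨Pi.single i c, by simp⟩
      rw [hr, finrank_top, Module.finrank_self, Module.finrank_fintype_fun_eq_card, Fintype.card_fin, ← hK] at h
      omega
    have hsup : Module.finrank (ZMod 2) ↥(D ⊔ K) ≤ M + 1 := by
      have h := Submodule.finrank_le (D ⊔ K)
      rw [Module.finrank_fintype_fun_eq_card, Fintype.card_fin] at h
      exact h
    have hmod := Submodule.finrank_sup_add_finrank_inf_eq D K
    rw [hD'rk]
    omega

end Slices

/-- **Registered stub `stub_slice`** of the path `coord` (stmt-PneNP-19683), BY NAME: the two slices along any coordinate form a coordinate layer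
family losing at most one dimension per point. -/
theorem stub_slice : ∀ M : ℕ, ∀ Y : Finset (Fin (M + 1) → ZMod 2), ∀ i : Fin (M + 1),
    IsCLayerFamily Y i [slice Y i 0, slice Y i 1] ∧
      dsum (M + 1) Y ≤ dsum M (slice Y i 0) + dsum M (slice Y i 1) + (Y.card : ℤ) := by
  intro M Y i
  classical
  refine ⟨isCLayerFamily_slices Y i, ?_⟩
  unfold dsum
  -- re-index each slice through `Fin.removeNth i`
  have hinj : ∀ c : ZMod 2, Set.InjOn (fun y : Fin (M + 1) → ZMod 2 => Fin.removeNth i y) ↑(Y.filter fun y => y i = c) := by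
    intro c y hy y' hy' h
    have e := (Finset.mem_filter.mp (Finset.mem_coe.mp hy)).2
    have e' := (Finset.mem_filter.mp (Finset.mem_coe.mp hy')).2
    have h' : Fin.removeNth i y = Fin.removeNth i y' := h
    rw [← Fin.insertNth_self_removeNth i y, ← Fin.insertNth_self_removeNth i y', e, e', h']
  have hsl : ∀ c : ZMod 2, ∑ x ∈ slice Y i c, ((M : ℤ) - (acodim M (slice Y i c) x : ℤ)) =
      ∑ y ∈ Y.filter (fun y => y i = c), ((M : ℤ) - (acodim M (slice Y i c) (Fin.removeNth i y) : ℤ)) := by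
    intro c
    unfold slice
    rw [Finset.sum_image (hinj c)]
  rw [hsl 0, hsl 1]
  -- split `Y` by the value of coordinate `i`
  have hsplit : ∀ f : (Fin (M + 1) → ZMod 2) → ℤ, ∑ y ∈ Y, f y =
      ∑ y ∈ Y.filter (fun y => y i = 0), f y + ∑ y ∈ Y.filter (fun y => y i = 1), f y := by
    intro f
    rw [← Finset.sum_filter_add_sum_filter_not Y (fun y => y i = 0)]
    congr 1
    apply Finset.sum_congr _ fun _ _ => rfl
    ext y
    simp only [Finset.mem_filter]
    constructor
    · rintro ⟨hy, h⟩
      exact ⟨hy, ((by decide : ∀ c : ZMod 2, c = 0 ∨ c = 1) (y i)).resolve_left h⟩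
    · rintro ⟨hy, h⟩
      exact ⟨hy, by rw [h]; exact one_ne_zero⟩
  have hcard : (Y.card : ℤ) = ∑ y ∈ Y, (1 : ℤ) := by simp
  rw [hcard, hsplit (fun y => ((M + 1 : ℕ) : ℤ) - (acodim (M + 1) Y y : ℤ)), hsplit (fun _ => (1 : ℤ))]
  -- termwise: each point loses at most one dimension
  have hterm : ∀ c : ZMod 2, ∀ y ∈ Y.filter (fun y => y i = c),
      (((M + 1 : ℕ) : ℤ) - (acodim (M + 1) Y y : ℤ)) ≤ ((M : ℤ) - (acodim M (slice Y i c) (Fin.removeNth i y) : ℤ)) + 1 := by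
    intro c y hy
    obtain ⟨hyY, hyc⟩ := Finset.mem_filter.mp hy
    have h := acodim_slice_le Y i hyY
    rw [hyc] at h
    push_cast
    omega
  have h0 := Finset.sum_le_sum (hterm 0)
  have h1 := Finset.sum_le_sum (hterm 1)
  rw [Finset.sum_add_distrib] at h0 h1
  linarith

end Summit.PneNP.PneNP.Theorems.ClusCoord
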